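import Mathlib
import Summits.Ventures.PercRepro2.SixTypedBridge
import Summits.Ventures.PercRepro2.SixTypedCover
import Summits.Ventures.PercRepro2.TypedResidualCore

/-!
# Six typed edges, XII: row 2′TRI on the reduced class with six typed edges — UNCONDITIONAL
(blind cell PercRepro2, night-3, 2026-08-25)

`allOk6 = true` (`SixTypedCover.lean`, the 252 kernel groups of the guarded enumeration of the
1,269 sorted labellings) discharges the finite hypothesis of the reduced-class bridge:
**`typedCount_nonneg_of_reduced_card_six'`** — every instance with exactly six typed edges that is
fully reduced (`Reduced`: no typed loop / root pair / parallel pair, no unmarked typed leaf or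
series vertex, `o` and `b` not typed leaves), with the marks distinct up to `b = a₃` / `o = b`
(`MarksDistinct`) and every other edge pinned closed, has a nonnegative typed base of `K₃` — the
smallest class of S4's domain of record (`ResidualCore`, `|F| ≥ 6`), closed without any
conjecture: the a₃-inactive instances included.
-/

namespace Summit.Ventures.PercRepro2

open UnionCluster

namespace CovForm

namespace TwoTyped

open OneTyped TypedRed

section All6

open Classical TypedRed

variable {V : Type*} {E : Type*} [DecidableEq V] [Fintype E] [DecidableEq E] {R : Type*} [Field R]
  [LinearOrder R] [IsStrictOrderedRing R]
variable (ends : E → Sym2 V) (o a₁ a₂ a₃ b : V)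

/-- **Six typed edges of a reduced instance** (unconditional). -/
theorem typedCount_sext_K3_nonneg' (hm : MarksDistinct o a₁ a₂ a₃ b)
    (e : Fin 6 → E) (hinj : Function.Injective e)
    (hred : Reduced ends o a₁ a₂ a₃ b (Finset.univ.image e)) (τ : E → ℕ)
    (hτ : ∀ i, τ (e i) = 1 ∨ τ (e i) = 2) :
    0 ≤ typedCount (Finset.univ.image e) (fun _ => false) τ
      (K3 ends o a₁ a₂ a₃ b : Config E → Config E → Config E → R) :=
  typedCount_sext_K3_nonneg ends o a₁ a₂ a₃ b allOk6_true hm e hinj hred τ hτ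

/-- **ROW 2′TRI ON THE REDUCED CLASS WITH SIX TYPED EDGES** (unconditional): every fully reduced
instance with exactly six typed edges, marks distinct up to `b = a₃` / `o = b`, every other edge
pinned closed, has a nonnegative typed base. -/
theorem typedCount_nonneg_of_reduced_card_six' (hm : MarksDistinct o a₁ a₂ a₃ b)
    (F : Finset E) (hF : F.card = 6) (hred : Reduced ends o a₁ a₂ a₃ b F) (τ : E → ℕ)
    (hτ : ∀ e ∈ F, τ e = 1 ∨ τ e = 2) :
    0 ≤ typedCount F (fun _ => false) τ (K3 ends o a₁ a₂ a₃ b : Config E → Config E → Config E → R) :=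
  typedCount_nonneg_of_reduced_card_six ends o a₁ a₂ a₃ b allOk6_true hm F hF hred τ hτ

/-- **The `|F| = 6` core instances of the crux are closed**: on `ResidualCore` with exactly six
typed edges, row 2′TRI holds (the hypotheses of `ResidualCore_all` at `F.card = 6`). -/
theorem typedCount_nonneg_of_residualCore_card_six (F : Finset E) (hF : F.card = 6)
    (hres : ResidualCore ends o a₁ a₂ a₃ b F) (τ : E → ℕ) (hτ : ∀ e ∈ F, τ e = 1 ∨ τ e = 2) :
    0 ≤ typedCount F (fun _ => false) τ (K3 ends o a₁ a₂ a₃ b : Config E → Config E → Config E → R) :=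
  typedCount_nonneg_of_reduced_card_six' ends o a₁ a₂ a₃ b hres.marks F hF
    hres.residualConR.residualCon.residual.reduced τ hτ

end All6

end TwoTyped

end CovForm

end Summit.Ventures.PercRepro2
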